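import Mathlib
import Literature.Probability.LatticeModels.GKSInequalities
import Summits.CriticalPhenomena.Ising3DConformalLimit.Theorems.PrecisionLaplacianInverseMFerromagnetEntryNonposOfPcov
import Summits.CriticalPhenomena.Ising3DConformalLimit.Theorems.PrecisionLaplacianInverseMFerromagnetImNonadjOfLaw2Aux
import HarnessLib

/-!
# Crux `PrecisionLaplacian.InverseMFerromagnet` (stmt-CriticalPhenomena-4798), line `Sketch` —
# auxiliary lemmas (part 2) for stub `stub_imNonadj_of_law2` (C2: non-adjacent pairs of degree ≤ 3 from `Law₂`)

THEOREM-ONLY helper file (no definitions), continuing `…ImNonadjOfLaw2Aux.lean`: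

* `c2_block`: if the rows of a positive definite `N` outside `S` are free (`N p k = 0`, `p ∉ S`,
  `k ≠ p`) and `u` vanishes outside `S`, then `u' ⬝ N⁻¹ u = u'_Sᵀ (N_SS)⁻¹ u_S`;
* `c2_res_degen`: the residual pairing `Res(f, g)` modulo the span of the `χ_p` vanishes when `f`
  is in that span (degenerate cubic);
* `c2_nu`: decimating two non-adjacent spins `x, y` whose `cosh h` factor through nonnegative pair
  interactions (star–triangle) gives a zero-field PAIR ferromagnet `ν` on the same sites, re-indexed
  by `Fin (m + 3 + 3)`, with `x, y` free and the same expectations off `σ_x, σ_y`;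
* `c2_law2_res`: `Law₂` applied to `ν` makes the residual `Res(σ_B, σ_A)` of two 3-sets avoiding
  `x, y` nonnegative (the free sites split off as a block, `c2_block`).
-/

namespace Summit.CriticalPhenomena.Ising3DConformalLimit.Cruxes.InverseMFerromagnet.PartialCovarianceLadder

open Literature.Probability.LatticeModels Finset Matrix

/-- **Block structure of the inverse.** If the rows of `N` outside `S` are "free" (`N p k = 0` for
`p ∉ S`, `k ≠ p`) and `u` vanishes outside `S`, then `u' ⬝ N⁻¹ u` is the quadratic form of the
inverse of the principal block `N_SS`. [folklore] -/
theorem c2_block {n : ℕ} (N : Matrix (Fin n) (Fin n) ℝ) (hN : N.PosDef) (S : Finset (Fin n))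
    (hNS : ∀ p, p ∉ S → ∀ k, k ≠ p → N p k = 0) (u u' : Fin n → ℝ)
    (hu : ∀ p, p ∉ S → u p = 0) :
    dotProduct u' (N⁻¹.mulVec u)
      = ∑ p : ↥S, ∑ q : ↥S, u' p.1
          * (N.submatrix (Subtype.val : ↥S → Fin n) (Subtype.val : ↥S → Fin n))⁻¹ p q * u q.1 := by
  set D : Matrix ↥S ↥S ℝ :=
    N.submatrix (Subtype.val : ↥S → Fin n) (Subtype.val : ↥S → Fin n) with hD
  have hDpd : D.PosDef := hN.submatrix Subtype.val_injective
  have hDD : D * D⁻¹ = 1 :=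
    Matrix.mul_nonsing_inv D ((Matrix.isUnit_iff_isUnit_det D).mp hDpd.isUnit)
  have hNN : N⁻¹ * N = 1 :=
    Matrix.nonsing_inv_mul N ((Matrix.isUnit_iff_isUnit_det N).mp hN.isUnit)
  obtain ⟨t, ht⟩ : ∃ t : ↥S → ℝ, t = D⁻¹.mulVec (fun q : ↥S => u q.1) := ⟨_, rfl⟩
  obtain ⟨ut, hut⟩ : ∃ ut : Fin n → ℝ, ∀ k, ut k = if hk : k ∈ S then t ⟨k, hk⟩ else 0 :=
    ⟨fun k => if hk : k ∈ S then t ⟨k, hk⟩ else 0, fun _ => rfl⟩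
  have hutS : ∀ k : ↥S, ut k.1 = t k := fun k => by rw [hut, dif_pos k.2]
  have hut0 : ∀ k, k ∉ S → ut k = 0 := fun k hk => by rw [hut, dif_neg hk]
  have hsumS : ∀ g : Fin n → ℝ, ∑ k, g k * ut k = ∑ k : ↥S, g k.1 * t k := by
    intro g
    rw [← Finset.sum_subset (Finset.subset_univ S)
      (fun k _ hk => by rw [hut0 k hk, mul_zero]), ← Finset.sum_coe_sort]
    exact Finset.sum_congr rfl fun k _ => by rw [hutS]
  have hNut : N.mulVec ut = u := by
    funext p
    simp only [Matrix.mulVec, dotProduct]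
    rw [hsumS]
    by_cases hp : p ∈ S
    · have h1 : (D.mulVec t) ⟨p, hp⟩ = u p := by
        rw [ht, Matrix.mulVec_mulVec, hDD, Matrix.one_mulVec]
      rw [← h1]
      simp only [Matrix.mulVec, dotProduct, hD, Matrix.submatrix_apply]
    · rw [hu p hp]
      exact Finset.sum_eq_zero fun k _ => by
        rw [hNS p hp k.1 (fun h => hp (h ▸ k.2)), zero_mul]
  have hsol : N⁻¹.mulVec u = ut := by
    rw [← hNut, Matrix.mulVec_mulVec, hNN, Matrix.one_mulVec]
  rw [hsol]
  simp only [dotProduct]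
  rw [hsumS]
  refine Finset.sum_congr rfl fun p _ => ?_
  rw [ht]
  simp only [Matrix.mulVec, dotProduct, Finset.mul_sum]
  exact Finset.sum_congr rfl fun q _ => by ring

/-- A residual `Res(f, g)` vanishes when `f` lies in the span of the `χ_p`. [folklore] -/
theorem c2_res_degen {Ω S' : Type*} [Fintype Ω] [Fintype S'] [DecidableEq S'] (P : Ω → ℝ)
    (χ : S' → Ω → ℝ) (M : Matrix S' S' ℝ) (hM : ∀ p q, M p q = ∑ ω, P ω * (χ p ω * χ q ω))
    (hdet : IsUnit M.det) (f g : Ω → ℝ) (ι : Fin 3 → S') (α : Fin 3 → ℝ) (k : ℝ) (j₀ : Fin 3)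
    (hf : ∀ ω, f ω = ∑ j, α j * χ (ι j) ω + k * χ (ι j₀) ω) :
    ∑ ω, P ω * (f ω * g ω)
        - ∑ p, ∑ q, (∑ ω, P ω * (f ω * χ p ω)) * M⁻¹ p q * (∑ ω, P ω * (g ω * χ q ω)) = 0 := by
  rw [c2_res_lin P χ M hM hdet f f g (fun o : Option (Fin 3) => o.elim (ι j₀) ι)
    (fun o => o.elim k α) 0 (fun ω => ?_), zero_mul]
  rw [hf ω, Fintype.sum_option]
  simp only [Option.elim_none, Option.elim_some, zero_mul, add_zero]
  ring

/-- **The decimated system `ν`.** Integrating out the two non-adjacent spins `x, y` (local fields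
`h_x`, `h_y`, `cosh h = e^c e^{S}` with `S` a nonnegative pair interaction on the three neighbours)
yields a zero-field pair ferromagnet on the same sites in which `x, y` are free, with the same
expectations of observables not involving `σ_x, σ_y`. [folklore] -/
theorem c2_nu {n m : ℕ} (K Kx Kxy : Fin m → ℝ) (C : Fin m → Finset (Fin n))
    (hKxy0 : ∀ i, 0 ≤ Kxy i) (hC : ∀ i, (C i).card = 2) (x y : Fin n)
    (hx hy : SpinConfig (Fin n) → ℝ) (cx cy : ℝ) (Jx Jy : Fin 3 → ℝ)
    (hJx : ∀ j, 0 ≤ Jx j) (hJy : ∀ j, 0 ≤ Jy j) (v w : Fin 3 → Fin n)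
    (hv : ∀ j, v j ≠ x ∧ v j ≠ y) (hw : ∀ j, w j ≠ y ∧ w j ≠ x)
    (hvd : v 0 ≠ v 1 ∧ v 0 ≠ v 2 ∧ v 1 ≠ v 2) (hwd : w 0 ≠ w 1 ∧ w 0 ≠ w 2 ∧ w 1 ≠ w 2)
    (hH1 : ∀ ω, gksHamiltonian Finset.univ K C ω
      = gksHamiltonian Finset.univ Kx C ω + spinAt x ω * hx ω)
    (hH2 : ∀ ω, gksHamiltonian Finset.univ Kx C ω
      = gksHamiltonian Finset.univ Kxy C ω + spinAt y ω * hy ω)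
    (hKx : ∀ i, x ∈ C i → Kx i = 0) (hKxy : ∀ i, y ∈ C i → Kxy i = 0)
    (hKxy' : ∀ i, x ∈ C i → Kxy i = 0)
    (hhx : ∀ ω, hx (ω * Pi.mulSingle x (-1)) = hx ω)
    (hhx' : ∀ ω, hx (ω * Pi.mulSingle y (-1)) = hx ω)
    (hhy : ∀ ω, hy (ω * Pi.mulSingle y (-1)) = hy ω)
    (hSx : ∀ ω, Real.cosh (hx ω) = Real.exp cx * Real.exp (Jx 0 * (spinAt (v 1) ω * spinAt (v 2) ω)
      + Jx 1 * (spinAt (v 0) ω * spinAt (v 2) ω) + Jx 2 * (spinAt (v 0) ω * spinAt (v 1) ω)))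
    (hSy : ∀ ω, Real.cosh (hy ω) = Real.exp cy * Real.exp (Jy 0 * (spinAt (w 1) ω * spinAt (w 2) ω)
      + Jy 1 * (spinAt (w 0) ω * spinAt (w 2) ω) + Jy 2 * (spinAt (w 0) ω * spinAt (w 1) ω))) :
    ∃ (m' : ℕ) (K' : Fin m' → ℝ) (C' : Fin m' → Finset (Fin n)), (∀ i, 0 ≤ K' i) ∧
      (∀ i, (C' i).card = 2) ∧ (∀ i, x ∈ C' i → K' i = 0) ∧ (∀ i, y ∈ C' i → K' i = 0) ∧
      ∀ f : SpinConfig (Fin n) → ℝ, (∀ ω, f (ω * Pi.mulSingle x (-1)) = f ω) →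
        (∀ ω, f (ω * Pi.mulSingle y (-1)) = f ω) →
        gksExpect Finset.univ K C f = gksExpect Finset.univ K' C' f := by
  obtain ⟨Cx, hCx⟩ : ∃ Cx : Fin 3 → Finset (Fin n), Cx = ![{v 1, v 2}, {v 0, v 2}, {v 0, v 1}] :=
    ⟨_, rfl⟩
  obtain ⟨Cy, hCy⟩ : ∃ Cy : Fin 3 → Finset (Fin n), Cy = ![{w 1, w 2}, {w 0, w 2}, {w 0, w 1}] :=
    ⟨_, rfl⟩
  obtain ⟨e, -⟩ : ∃ _e : (Fin m ⊕ Fin 3) ⊕ Fin 3 ≃ Fin (m + 3 + 3), True :=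
    ⟨(Equiv.sumCongr finSumFinEquiv (Equiv.refl (Fin 3))).trans finSumFinEquiv, trivial⟩
  have hvx : ∀ j, x ≠ v j := fun j => (hv j).1.symm
  have hvy : ∀ j, y ≠ v j := fun j => (hv j).2.symm
  have hwy : ∀ j, y ≠ w j := fun j => (hw j).1.symm
  have hwx : ∀ j, x ≠ w j := fun j => (hw j).2.symm
  refine ⟨m + 3 + 3, Sum.elim (Sum.elim Kxy Jx) Jy ∘ e.symm, Sum.elim (Sum.elim C Cx) Cy ∘ e.symm,
    fun i => ?_, fun i => ?_, fun i => ?_, fun i => ?_, fun f hfx hfy => ?_⟩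
  · simp only [Function.comp_apply]
    rcases e.symm i with (i' | j) | j
    · exact hKxy0 i'
    · exact hJx j
    · exact hJy j
  · simp only [Function.comp_apply]
    rcases e.symm i with (i' | j) | j
    · exact hC i'
    · fin_cases j <;> simp only [Sum.elim_inl, Sum.elim_inr, hCx] <;>
        simp [Finset.card_pair hvd.1, Finset.card_pair hvd.2.1, Finset.card_pair hvd.2.2]
    · fin_cases j <;> simp only [Sum.elim_inr, hCy] <;>
        simp [Finset.card_pair hwd.1, Finset.card_pair hwd.2.1, Finset.card_pair hwd.2.2]
  · simp only [Function.comp_apply]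
    rcases e.symm i with (i' | j) | j
    · exact hKxy' i'
    · fin_cases j <;> simp [hCx, hvx]
    · fin_cases j <;> simp [hCy, hwx]
  · simp only [Function.comp_apply]
    rcases e.symm i with (i' | j) | j
    · exact hKxy i'
    · fin_cases j <;> simp [hCx, hvy]
    · fin_cases j <;> simp [hCy, hwy]
  · refine c2_decimate K Kx Kxy C _ _ x y hx hy
      (fun ω => Jx 0 * (spinAt (v 1) ω * spinAt (v 2) ω) + Jx 1 * (spinAt (v 0) ω * spinAt (v 2) ω)
        + Jx 2 * (spinAt (v 0) ω * spinAt (v 1) ω))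
      (fun ω => Jy 0 * (spinAt (w 1) ω * spinAt (w 2) ω) + Jy 1 * (spinAt (w 0) ω * spinAt (w 2) ω)
        + Jy 2 * (spinAt (w 0) ω * spinAt (w 1) ω))
      cx cy hH1 hH2 hKx hKxy hhx hhx' hhy hSx hSy (fun ω => ?_) f hfx hfy
    calc gksHamiltonian Finset.univ (Sum.elim (Sum.elim Kxy Jx) Jy ∘ e.symm)
          (Sum.elim (Sum.elim C Cx) Cy ∘ e.symm) ω
        = gksHamiltonian Finset.univ (Sum.elim (Sum.elim Kxy Jx) Jy)
            (Sum.elim (Sum.elim C Cx) Cy) ω := by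
          unfold gksHamiltonian
          exact Fintype.sum_equiv e.symm _ _ (fun _ => rfl)
      _ = _ := by
          simp only [gksHamiltonian, Fintype.sum_sum_type, Sum.elim_inl, Sum.elim_inr,
            Fin.sum_univ_three, hCx, hCy, Matrix.cons_val_zero, Matrix.cons_val_one,
            Matrix.cons_val_two, Matrix.head_cons, Matrix.tail_cons,
            c2_spinProduct_pair hvd.1, c2_spinProduct_pair hvd.2.1, c2_spinProduct_pair hvd.2.2,
            c2_spinProduct_pair hwd.1, c2_spinProduct_pair hwd.2.1, c2_spinProduct_pair hwd.2.2]

/-- **`Law₂` for the decimated system gives a nonnegative residual.**  If `ν = gksExpect univ K' C'`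
is a pair ferromagnet in which `x, y` are free and which has the same expectations as
`μ = gksExpect univ K C` on observables not involving `σ_x, σ_y`, then for 3-sets `A, B` avoiding
`x, y`: `⟨σ_Bσ_A⟩_μ − ∑_{p,q ∉ {x,y}} ⟨σ_Bσ_p⟩_μ ((Σ_μ)_SS)⁻¹_pq ⟨σ_Aσ_q⟩_μ ≥ 0`. [folklore] -/
theorem c2_law2_res
    (hlaw : ∀ (n m : ℕ) (K : Fin m → ℝ) (C : Fin m → Finset (Fin n)), (∀ i, 0 ≤ K i) →
      (∀ i, (C i).card = 2) → ∀ (A B : Finset (Fin n)), A.card = 3 → B.card = 3 →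
        dotProduct (fun w => gksExpect Finset.univ K C (fun ω => spinProduct A ω * spinAt w ω))
          (((Matrix.of fun p q : Fin n =>
              gksExpect Finset.univ K C (fun ω => spinAt p ω * spinAt q ω))⁻¹).mulVec
            (fun w => gksExpect Finset.univ K C (fun ω => spinProduct B ω * spinAt w ω)))
        ≤ gksExpect Finset.univ K C (fun ω => spinProduct A ω * spinProduct B ω))
    {n m m' : ℕ} (K : Fin m → ℝ) (C : Fin m → Finset (Fin n)) (K' : Fin m' → ℝ)
    (C' : Fin m' → Finset (Fin n)) (hK' : ∀ i, 0 ≤ K' i) (hC' : ∀ i, (C' i).card = 2) (x y : Fin n)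
    (hX : ∀ i, x ∈ C' i → K' i = 0) (hY : ∀ i, y ∈ C' i → K' i = 0)
    (hdec : ∀ f : SpinConfig (Fin n) → ℝ, (∀ ω, f (ω * Pi.mulSingle x (-1)) = f ω) →
      (∀ ω, f (ω * Pi.mulSingle y (-1)) = f ω) →
      gksExpect Finset.univ K C f = gksExpect Finset.univ K' C' f)
    (S : Finset (Fin n)) (hS2 : ∀ p, p ∉ S → p = x ∨ p = y) (hS1 : ∀ p : ↥S, p.1 ≠ x ∧ p.1 ≠ y)
    (A B : Finset (Fin n)) (hA : A.card = 3) (hB : B.card = 3)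
    (hxA : x ∉ A) (hyA : y ∉ A) (hxB : x ∉ B) (hyB : y ∉ B) :
    0 ≤ gksExpect Finset.univ K C (fun ω => spinProduct B ω * spinProduct A ω)
      - ∑ p : ↥S, ∑ q : ↥S,
        gksExpect Finset.univ K C (fun ω => spinProduct B ω * spinAt p.1 ω)
          * ((Matrix.of fun p q : Fin n =>
              gksExpect Finset.univ K C (fun ω => spinAt p ω * spinAt q ω)).submatrix
                (Subtype.val : ↥S → Fin n) (Subtype.val : ↥S → Fin n))⁻¹ p q
          * gksExpect Finset.univ K C (fun ω => spinProduct A ω * spinAt q.1 ω) := by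
  have hl := hlaw n m' K' C' hK' hC' B A hB hA
  set N : Matrix (Fin n) (Fin n) ℝ :=
    Matrix.of fun p q : Fin n => gksExpect Finset.univ K' C' (fun ω => spinAt p ω * spinAt q ω)
    with hN
  have hNpd : N.PosDef := schur_posDef n m' K' C'
  have hNS : ∀ p, p ∉ S → ∀ k, k ≠ p → N p k = 0 := by
    intro p hp k hk
    rcases hS2 p hp with rfl | rfl
    · exact c2_free K' C' _ hX (spinAt k) (fun ω => pcm2im_spinAt_flip_ne hk ω)
    · exact c2_free K' C' _ hY (spinAt k) (fun ω => pcm2im_spinAt_flip_ne hk ω)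
  have hu : ∀ p, p ∉ S →
      gksExpect Finset.univ K' C' (fun ω => spinProduct A ω * spinAt p ω) = 0 := by
    intro p hp
    have h1 : (fun ω => spinProduct A ω * spinAt p ω) = fun ω => spinAt p ω * spinProduct A ω :=
      funext fun ω => mul_comm _ _
    rw [h1]
    rcases hS2 p hp with rfl | rfl
    · exact c2_free K' C' _ hX _ (c2_spinProduct_flip hxA)
    · exact c2_free K' C' _ hY _ (c2_spinProduct_flip hyA)
  rw [c2_block N hNpd S hNS _ _ hu] at hl
  have hinv : ∀ (D : Finset (Fin n)) (p : ↥S), x ∉ D → y ∉ D →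
      gksExpect Finset.univ K C (fun ω => spinProduct D ω * spinAt p.1 ω)
        = gksExpect Finset.univ K' C' (fun ω => spinProduct D ω * spinAt p.1 ω) :=
    fun D p hxD hyD => hdec _
      (fun ω => by rw [c2_spinProduct_flip hxD, pcm2im_spinAt_flip_ne (hS1 p).1])
      (fun ω => by rw [c2_spinProduct_flip hyD, pcm2im_spinAt_flip_ne (hS1 p).2])
  have e1 : gksExpect Finset.univ K C (fun ω => spinProduct B ω * spinProduct A ω)
      = gksExpect Finset.univ K' C' (fun ω => spinProduct B ω * spinProduct A ω) :=
    hdec _ (fun ω => by rw [c2_spinProduct_flip hxB, c2_spinProduct_flip hxA])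
      (fun ω => by rw [c2_spinProduct_flip hyB, c2_spinProduct_flip hyA])
  have hsub : (Matrix.of fun p q : Fin n =>
      gksExpect Finset.univ K C (fun ω => spinAt p ω * spinAt q ω)).submatrix
        (Subtype.val : ↥S → Fin n) (Subtype.val : ↥S → Fin n)
      = N.submatrix (Subtype.val : ↥S → Fin n) (Subtype.val : ↥S → Fin n) := by
    ext p q
    simp only [Matrix.submatrix_apply, hN, Matrix.of_apply]
    exact hdec _
      (fun ω => by rw [pcm2im_spinAt_flip_ne (hS1 p).1, pcm2im_spinAt_flip_ne (hS1 q).1])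
      (fun ω => by rw [pcm2im_spinAt_flip_ne (hS1 p).2, pcm2im_spinAt_flip_ne (hS1 q).2])
  rw [e1, hsub]
  simp only [hinv B _ hxB hyB, hinv A _ hxA hyA]
  linarith [hl]

/-- Registered helper `helper_c2_block` (representative of this auxiliary file): the block
structure of the inverse when the rows outside `S` are free (`c2_block`). [folklore] -/
theorem helper_c2_block : ∀ (n : ℕ) (N : Matrix (Fin n) (Fin n) ℝ), N.PosDef → ∀ (S : Finset (Fin n)), (∀ p, p ∉ S → ∀ k, k ≠ p → N p k = 0) → ∀ (u u' : Fin n → ℝ), (∀ p, p ∉ S → u p = 0) → dotProduct u' (N⁻¹.mulVec u) = ∑ p : ↥S, ∑ q : ↥S, u' p.1 * (N.submatrix (Subtype.val : ↥S → Fin n) (Subtype.val : ↥S → Fin n))⁻¹ p q * u q.1 :=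
  fun _ N hN S hNS u u' hu => c2_block N hN S hNS u u' hu

end Summit.CriticalPhenomena.Ising3DConformalLimit.Cruxes.InverseMFerromagnet.PartialCovarianceLadder
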